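import Literature.NumberTheory.EllipticCurves.PastenValuationProductThm75ExplicitProofs
import Literature.NumberTheory.EllipticCurves.PastenCongruenceModulusSizeProofs
import Literature.NumberTheory.EllipticCurves.DeligneHeckeEigenvalueBound
import Literature.NumberTheory.Sieve.DivisorBound
import HarnessLib

/-!
# Pasten, *Shimura curves and the abc conjecture*, Thm 7.5 (asymptotic discriminant clause) —
# the remaining input, Thm 7.2 (asymptotic clause), reduced to its printed inputs

Topic `NumberTheory/EllipticCurves`; namespace `Literature.NumberTheory.EllipticCurves` (helpers in
the sub-namespace `….Pasten2024`, as in the siblings `PastenValuationProductThm75Proofs.lean` and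
`PastenValuationProductThm75ExplicitProofs.lean`). A proofs-only companion (theorems only: NO
definition, NO new named fact, nothing restated; D-0026) of the named fact `pasten_thm_7_5` of
`Literature/NumberTheory/EllipticCurves/PastenValuationProduct.lean`:
*"Let `ε > 0`. For all elliptic curves `E/ℚ` of conductor `N ≫_ε 1`, `log|Δ_E| < (1/4 + ε) N log N`"*
— H. Pasten, J. Number Theory 254 (2024) = arXiv:1705.09251, Thm 7.5 (p. 27 of the arXiv text).

## Where the story stands (siblings) and what this file adds

After `PastenValuationProductThm75Proofs.lean` the fact `pasten_thm_7_5` follows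
(`pasten_thm_7_5_of_modularity_of_optimalDegreeBound`) from (i) modularity with an integral Manin
constant (`nonempty_modularParametrizationData`), (ii) Mazur–Kenku (`minimal degree ≤ 163 · δ_{1,N}`,
`PastenShimura2024_minimalDegree_le_163_mul`) and (iii) `hδ`, the ASYMPTOTIC clause of Thm 7.2:
*"given any `ε > 0`, for `N ≫_ε 1` … `log δ_{1,N} < (1/24 + ε) N log N`"* (p. 26), with `δ_{1,N}`
read, as in `PastenShimura2024_thm_5_5`, as the degree of a datum of minimal degree among all data
at level `N` with the same newform. Thm 7.2 is not vendored in the tree. Its printed proof (p. 26):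

> "Varying `c ≠ [χ_{D,M}]` … Theorem 5.5 gives `log δ_{D,M} ≤ Σ_{c ≠ [χ_{D,M}]} log η_{[χ_{D,M}]}(c)`
> … Here we used the fact that `r_{D,M} = Σ_c #c` … By Proposition 7.1 we obtain the claimed
> explicit bound. The proof of the asymptotic bound is similar, but using instead the (effective)
> estimate `n_c ≪_ε N^{1+ε}` from Lemma 11 in [MurtyBounds]."

and, for each class `c`, `η_{[χ₀]}(c) ≤ |P(a_{n_c}(f))| ≤ (2 d(n_c) n_c^{1/2})^{#c}` by Prop 5.4 and
"the Hasse–Weil bound on the Fourier coefficients of a normalized eigenform of weight `2`".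
This file carries out exactly this deduction of the asymptotic clause over the tree, in the
vocabulary of `PastenSpectralDegree.lean` / `PastenCongruenceModulusSizeProofs.lean` (classes
`c ≠ [χ₀]` = minimal primes `P ≠ 𝕀_{[χ₀]}` of `𝕋 = anemicHeckeRing N 2`, `#c = rank_ℤ(𝕋 ⧸ P)`):

* `Pasten2024.log_heckeCongruenceModulus_le_of_distinguishingIndex` — **`log η_{[χ₀]}(P) ≤
  #c · (log 4 + ½ log X)`** whenever every pair of newforms `f` (level `N`), `g` (level `M ∣ N`)
  differing at some index prime to `N` already differs at such an index `≤ X`, granted the weight-2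
  Ramanujan bound `|μ| ≤ 2√p` for the eigenvalues of `T_p` on `S₂(Γ₀(N))` (hypothesis `h2`; in the
  tree the named fact `Deligne1974_heckeT_eigenvalue_norm_le`, weight-2 case). The proof is that
  of `PastenShimura2024_log_heckeCongruenceModulus_lt_of_weight_two_bound` (sibling
  `PastenCongruenceModulusSizeProofs.lean`, PROVED: `P = 𝕀` of an Atkin–Lehner form of a newform
  `g`, `exists_isNewform0_eigenIdeal_eq_of_mem_minimalPrimes`; `η ≤ (2√p + |a_p(f)|)^{#c}`,
  `heckeCongruenceModulus_le_pow_finrank`) with the Sturm-bound distinguishing prime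
  `p ≤ N²(1 + log N)/6` replaced by a distinguishing prime `p ≤ n_c ≤ X` (the least index prime to
  `N` at which two normalised eigenforms differ is prime: `IsNewform0.coeff_eq_of_coprime_of_lt`,
  so `d(n_c)` does not enter).
* `Pasten2024.log_modularDegree_le_card_mul_of_distinguishingIndex` — with Thm 5.5
  (`PastenShimura2024_thm_5_5`): `log δ_{1,N} ≤ (Σ_{c ≠ [χ₀]} #c)(log 4 + ½ log X)`.
* `Pasten2024.exists_propBound_le` — Prop 7.1, second display, from the first:
  `N/12 + (7/12) d(N²) ≤ (1/12 + ε) N` for `N ≫_ε 1` (PROVED, by the divisor bound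
  `d(n) ≪ n^{1/4}` of `Literature/NumberTheory/Sieve/DivisorBound.lean`).
* `Pasten2024.log_modularDegree_lt_of_thm_5_5_asymptotic` — **Thm 7.2, asymptotic clause**
  (`D = 1`): `log δ_{1,N} < (1/24 + ε) N log N` for `N ≥ N₁(ε)`, from Thm 5.5, `h2`, and the two
  un-vendored printed inputs as hypotheses: `hMurty` — Lemma 11 of [MurtyBounds] in the form used on
  p. 26 (*"n_c ≪_ε N^{1+ε}"*: newforms `f ∈ S₂(Γ₀(N))`, `g ∈ S₂(Γ₀(M))`, `M ∣ N`, differing at an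
  index prime to `N` differ at such an index `≤ C_ε N^{1+ε}`), and `hr` — Prop 7.1 as used on p. 26,
  `Σ_{c ≠ [χ₀]} #c ≤ N/12 + (7/12) d(N²)` (`r_{1,N} − 1`, G. Martin's dimension bound), in exactly
  the shape of the sibling's `pasten_thm_7_5_explicit_of_modularity_of_thm_5_5`, so that one
  vendored statement serves both clauses. Arithmetic: with `κ = min(ε/3, 1)` in both inputs,
  `(1/12 + κ)(1 + κ)/2 ≤ 1/24 + 25ε/72` and the linear term `(1/12 + κ)(log 4 + ½ log C) N` is
  `≤ (ε/8) N log N` for large `N`.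
* `pasten_thm_7_5_of_modularity_of_thm_5_5` — **Thm 7.5 (asymptotic) from modularity,
  Mazur–Kenku, Thm 5.5, Deligne's bound, Murty's Lemma 11 (`hMurty`) and Prop 7.1 (`hr`)**; and
  `…_of_weight_two_bound`, the same with the weight-2 Ramanujan bound as a bare hypothesis.

## Status of `pasten_thm_7_5`

`pasten_thm_7_5_holds` is NOT here: it needs the Modularity Theorem
(`nonempty_modularParametrizationData`, unproved in the tree) and the two printed inputs of the
asymptotic clause of Thm 7.2 that the tree does not vendor — Murty's Lemma 11 (whose proof is the
Rankin–Selberg method with the level-uniform convexity bound and the Hoffstein–Lockhart lower bound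
for `(f, f)`; [MurtyBounds] §6) and Prop 7.1 (G. Martin's `dim S₂(n)^{new} ≤ φ(n)/12 + (7/12)2^{ω(n)} + μ(n)`).
Nothing else of the printed proof of Thm 7.5 remains unproved: Silverman's (EqDiscH), Zagier's
formula, the trivial Petersson bound, the size of `η` from a distinguishing prime, the divisor
bound and all the bookkeeping are theorems of the tree.

## References

* H. Pasten, *Shimura curves and the abc conjecture*, J. Number Theory 254 (2024) 214–335,
  doi:10.1016/j.jnt.2023.07.002 = arXiv:1705.09251: §3 p. 13, Prop 7.1 and Thm 7.2 with its proof
  (p. 26), §7.4 Thm 7.5 (p. 27). [PastenShimura2024]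
* M. R. Murty, *Bounds for congruence primes*, in: Automorphic forms, automorphic representations,
  and arithmetic, Proc. Sympos. Pure Math. 66.1 (1999) 177–192, §6 Lemma 11 (read in the author's
  preprint `degree.dvi`, p. 11: "there is an `n = O(N^{1+ε} M^ε)` such that `(n, M) = 1` and
  `a_n(f) ≠ a_n(g)`"). [Murty1999CongruencePrimes]
* G. Martin, *Dimensions of the spaces of cusp forms and newforms on `Γ₀(N)` and `Γ₁(N)`*,
  J. Number Theory 112 (2005) 298–331, doi:10.1016/j.jnt.2004.10.009, Thm 1 and Lemma 17
  (cited as [GregMartin] in [PastenShimura2024]).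
* P. Deligne, *La conjecture de Weil. I*, Publ. Math. IHÉS 43 (1974), Thm 8.2. [Deligne1974]
-/

noncomputable section

open scoped MatrixGroups ModularForm

open WeierstrassCurve CongruenceSubgroup UpperHalfPlane

namespace Literature.NumberTheory.EllipticCurves

open ModularForms

namespace Pasten2024

/-! ### Real-arithmetic bookkeeping -/

/-- For `ε > 0` and any real `K`: `K · n ≤ ε · n · log n` for all large naturals `n`
(`log n ≥ K/ε` once `n ≥ e^{K/ε}`). [folklore] -/
theorem exists_mul_le_mul_mul_log {ε : ℝ} (hε : 0 < ε) (K : ℝ) :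
    ∃ M : ℕ, ∀ n : ℕ, M ≤ n → K * n ≤ ε * n * Real.log n := by
  refine ⟨⌈Real.exp (K / ε)⌉₊ + 1, fun n hn => ?_⟩
  have hn1 : (1 : ℝ) ≤ n := by exact_mod_cast le_trans (Nat.le_add_left 1 _) hn
  have hnpos : (0 : ℝ) < n := by linarith
  have hexp : Real.exp (K / ε) ≤ n := by
    have h1 : Real.exp (K / ε) ≤ ⌈Real.exp (K / ε)⌉₊ := Nat.le_ceil _
    have h2 : ((⌈Real.exp (K / ε)⌉₊ + 1 : ℕ) : ℝ) ≤ n := by exact_mod_cast hn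
    push_cast at h2
    linarith
  have hlog : K / ε ≤ Real.log n := (Real.le_log_iff_exp_le hnpos).mpr hexp
  have hK : K ≤ ε * Real.log n := by
    rw [div_le_iff₀' hε] at hlog
    exact hlog
  calc K * n ≤ (ε * Real.log n) * n := mul_le_mul_of_nonneg_right hK hnpos.le
    _ = ε * n * Real.log n := by ring

/-- **Prop 7.1, second display, from the first** (p. 26: "Thus, given `ε > 0`, for `N ≫_ε 1` with
an effective implicit constant, we have `r_{D,M} < (1/12 + ε) φ(D) M`"; here `D = 1`, `M = N`,
for the quantity `N/12 + (7/12) d(N²)` bounding `r_{1,N} − 1`): `N/12 + (7/12) d(N²) ≤ (1/12 + ε) N`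
for `N ≥ N₁(ε)`, by the divisor bound `d(n) ≤ C n^{1/4}` (Hardy–Wright Thm 315,
`Sieve.exists_card_divisors_le_mul_rpow'`): `d(N²) ≤ C √N ≤ (12 ε / 7) N` once `√N ≥ 7C/(12ε)`.
[cite: PastenShimura2024, Prop. 7.1 (p. 26)] -/
theorem exists_propBound_le {ε : ℝ} (hε : 0 < ε) :
    ∃ N₁ : ℕ, ∀ N : ℕ, N₁ ≤ N →
      (N : ℝ) / 12 + 7 / 12 * ((N ^ 2).divisors.card : ℝ) ≤ (1 / 12 + ε) * N := by
  obtain ⟨C, hC1, hC⟩ := Sieve.exists_card_divisors_le_mul_rpow' (ε := 1 / 4) (by norm_num)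
  refine ⟨⌈(7 * C / (12 * ε)) ^ 2⌉₊, fun N hN => ?_⟩
  have hN0 : (0 : ℝ) ≤ N := Nat.cast_nonneg N
  have hC0 : 0 ≤ C := le_trans zero_le_one hC1
  -- `d(N²) ≤ C (N²)^{1/4} = C √N`
  have hd : (((N ^ 2).divisors.card : ℕ) : ℝ) ≤ C * Real.sqrt N := by
    have h := hC (N ^ 2)
    have e : ((N ^ 2 : ℕ) : ℝ) ^ (1 / 4 : ℝ) = Real.sqrt N := by
      rw [Nat.cast_pow, ← Real.rpow_natCast, ← Real.rpow_mul hN0, Real.sqrt_eq_rpow]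
      norm_num
    rwa [e] at h
  -- `√N ≥ 7C/(12ε)`
  have hsqrt : 7 * C / (12 * ε) ≤ Real.sqrt N := by
    have h1 : (7 * C / (12 * ε)) ^ 2 ≤ N := le_trans (Nat.le_ceil _) (by exact_mod_cast hN)
    have hpos : 0 ≤ 7 * C / (12 * ε) := by positivity
    calc 7 * C / (12 * ε) = Real.sqrt ((7 * C / (12 * ε)) ^ 2) := (Real.sqrt_sq hpos).symm
      _ ≤ Real.sqrt N := Real.sqrt_le_sqrt h1
  -- `(7/12) C √N ≤ ε N`
  have hkey : 7 / 12 * (C * Real.sqrt N) ≤ ε * N := by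
    have h1 : 7 * C / 12 ≤ ε * Real.sqrt N := by
      have h := mul_le_mul_of_nonneg_left hsqrt hε.le
      have e : ε * (7 * C / (12 * ε)) = 7 * C / 12 := by
        field_simp
      linarith
    calc 7 / 12 * (C * Real.sqrt N) = (7 * C / 12) * Real.sqrt N := by ring
      _ ≤ (ε * Real.sqrt N) * Real.sqrt N := mul_le_mul_of_nonneg_right h1 (Real.sqrt_nonneg _)
      _ = ε * N := by rw [mul_assoc, Real.mul_self_sqrt hN0]
  have hd' : 7 / 12 * (((N ^ 2).divisors.card : ℕ) : ℝ) ≤ 7 / 12 * (C * Real.sqrt N) :=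
    mul_le_mul_of_nonneg_left hd (by norm_num)
  calc (N : ℝ) / 12 + 7 / 12 * ((N ^ 2).divisors.card : ℝ)
      ≤ N / 12 + ε * N := by linarith
    _ = (1 / 12 + ε) * N := by ring

/-! ### The size of `η_{[χ₀]}(c)` from a distinguishing index `n_c ≤ X` -/

variable {N : ℕ} [NeZero N] {W : WeierstrassCurve ℚ}

/-- **`log η_{[χ₀]}(c) ≤ #c · (log 4 + ½ log X)` from a distinguishing index `n_c ≤ X`** (Pasten,
proof of Thm 7.2, p. 26, the chain `η_{[χ₀]}(c) ≤ |P(a_{n_c}(f))| ≤ (2 d(n_c) n_c^{1/2})^{#c}` with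
`n_c` the distinguishing index, here run — as in the sibling
`PastenShimura2024_log_heckeCongruenceModulus_lt_of_weight_two_bound` — with a distinguishing PRIME
`p ≤ n_c`, so that `d` does not enter: `η ≤ (2√p + |a_p(f)|)^{#c} ≤ (4√p)^{#c}`). Hypotheses:
`h2`, the weight-2 Ramanujan–Petersson bound `|μ| ≤ 2√p` for the eigenvalues of `T_p` (`p ∤ N`) on
`S₂(Γ₀(N))` ("the Hasse–Weil bound on the Fourier coefficients of a normalized eigenform of weight
2"; in the tree `Deligne1974_heckeT_eigenvalue_norm_le.weight_two`); `hX`, a bound `X` for the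
distinguishing index at level `N`: newforms `f ∈ S₂(Γ₀(N))`, `g ∈ S₂(Γ₀(M))`, `M ∣ N`, which differ
at some index prime to `N` differ at such an index `≤ X` (for Pasten's explicit clause
`X = N²(1 + log N)/6` by Sturm; for the asymptotic clause `X = C_ε N^{1+ε}`, Murty's Lemma 11).
Conclusion, for a datum `D` of an elliptic `W` at level `N` (`χ₀` = the system of `D.f`) and a
minimal prime `P ≠ 𝕀_{[χ₀]}` of `𝕋` (a class `c ≠ [χ₀]`, `#c = rank_ℤ(𝕋 ⧸ P)`):
`log η_{[χ₀]}(P) ≤ #c (log 4 + ½ log X)`. [cite: PastenShimura2024, proof of Thm. 7.2, p. 26] -/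
theorem log_heckeCongruenceModulus_le_of_distinguishingIndex
    (h2 : ∀ (N : ℕ) [NeZero N] (p : ℕ) [NeZero p], p.Prime → ¬ p ∣ N → ∀ μ : ℂ,
      Module.End.HasEigenvalue (heckeT (Gamma0 N) 2 p) μ → ‖μ‖ ≤ 2 * Real.sqrt p)
    {X : ℝ}
    (hX : ∀ (M : ℕ) [NeZero M], M ∣ N →
      ∀ (f : CuspForm (Gamma0 N) 2) (g : CuspForm (Gamma0 M) 2), IsNewform0 f → IsNewform0 g →
        (∃ n : ℕ, n.Coprime N ∧ (qExpansion 1 ⇑f).coeff n ≠ (qExpansion 1 ⇑g).coeff n) →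
          ∃ n : ℕ, n.Coprime N ∧ (n : ℝ) ≤ X ∧
            (qExpansion 1 ⇑f).coeff n ≠ (qExpansion 1 ⇑g).coeff n)
    [W.IsElliptic] (D : ModularParametrizationData W N) {P : Ideal (anemicHeckeRing N 2)}
    (hP : P ∈ minimalPrimes (anemicHeckeRing N 2)) (hPne : P ≠ eigenIdeal D.f) :
    Real.log (heckeCongruenceModulus D.f P) ≤
      (Module.finrank ℤ (anemicHeckeRing N 2 ⧸ P) : ℝ) * (Real.log 4 + Real.log X / 2) := by
  have hf := D.hasIntegralEigenvalues_f
  have hf0 := D.f_ne_zero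
  have hnew : IsNewform0 D.f := D.isNewformOf.1
  -- (1) `P` is the eigen-ideal of an Atkin–Lehner form of a newform `g` of level `M ∣ N`
  obtain ⟨x, g, hg, hφ0, hPφ⟩ := exists_isNewform0_eigenIdeal_eq_of_mem_minimalPrimes hP
  have hMN : x.1.1 ∣ N := (dvd_mul_right _ _).trans x.2
  -- (2) `f` and `g` differ at some index prime to `N` (else `P = 𝕀_{[χ₀]}`)
  have hdiff : ∃ n : ℕ, n.Coprime N ∧ (qExpansion 1 ⇑D.f).coeff n ≠ (qExpansion 1 ⇑g).coeff n := by
    by_contra hcon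
    push Not at hcon
    have heq : eigenIdeal (degeneracyMap0 x.1.1 N x.1.2 2 g) = eigenIdeal D.f := by
      refine eigenIdeal_eq_of_forall_heckeT_eq_smul (isAnemicEigenvector_degeneracyMap0 x hg) hφ0
        hf.isAnemicEigenvector hf0 fun p hp hpN ↦ ?_
      haveI : NeZero p := ⟨hp.ne_zero⟩
      refine ⟨(qExpansion 1 ⇑g).coeff p, heckeT_degeneracyMap0_eq_coeff_smul x hg p hp hpN, ?_⟩
      rw [← hcon p ((Nat.Prime.coprime_iff_not_dvd hp).mpr hpN)]
      exact hnew.heckeT_eq_coeff_smul hp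
    exact hPne (hPφ.trans heq)
  -- (2') hence (`hX`) at an index `n ≤ X` prime to `N`, hence at a PRIME `p ≤ n ≤ X`, `p ∤ N`
  obtain ⟨n, hn, hnX, hne_n⟩ := hX x.1.1 hMN D.f g hnew hg hdiff
  have hdist : ∃ p : ℕ, p.Prime ∧ ¬ p ∣ N ∧ (p : ℝ) ≤ X ∧
      (qExpansion 1 ⇑D.f).coeff p ≠ (qExpansion 1 ⇑g).coeff p := by
    by_contra hcon
    push Not at hcon
    refine hne_n (hnew.coeff_eq_of_coprime_of_lt hg hMN (B := n + 1) (fun p hp hpN hpB ↦ ?_) hn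
      (Nat.lt_succ_self n))
    have hpn : (p : ℝ) ≤ n := by exact_mod_cast Nat.lt_succ_iff.mp hpB
    exact hcon p hp hpN (hpn.trans hnX)
  obtain ⟨p, hp, hpN, hpX, hne⟩ := hdist
  haveI : NeZero p := ⟨hp.ne_zero⟩
  -- (3) `t = T_p`, `a = χ₀(T_p) = a_p(f)`, and `T_p - a ∉ P`
  set t : anemicHeckeRing N 2 := anemicHeckeRing.T N 2 p hp hpN with ht
  set a : ℤ := intEigencharacter hf hf0 t with ha_def
  have ha : (a : ℂ) = (qExpansion 1 ⇑D.f).coeff p := by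
    rw [ha_def, cast_intEigencharacter, ht, eigencharacter_T,
      heckeEigenvalue_eq_coeff_of_isNormalized hnew.2.2 hp (hnew.2.1 p hp)]
  have htP : t - (a : anemicHeckeRing N 2) ∉ P := by
    rw [hPφ, T_sub_intCast_mem_eigenIdeal_iff hφ0 hp hpN
      (heckeT_degeneracyMap0_eq_coeff_smul x hg p hp hpN), ha]
    exact fun h ↦ hne h.symm
  -- (4) the monic integer polynomial killing `T_p`, with roots bounded by `2 √p`
  obtain ⟨q, -, hq0, hroots⟩ := exists_monic_aeval_heckeT_eq_zero_norm_le N 2 p hp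
    (fun μ hμ ↦ h2 N p hp hpN μ hμ)
  have hqt : Polynomial.aeval t q = 0 := by
    have h1 := Polynomial.aeval_algHom_apply (anemicHeckeRing N 2).val t q
    rw [Subalgebra.coe_val, ht, anemicHeckeRing.coe_T, hq0] at h1
    rw [ht]
    exact Subtype.ext (h1.symm.trans (ZeroMemClass.coe_zero _).symm)
  -- (5) `|a| ≤ 2 √p` (`f` is a `T_p`-eigenvector with eigenvalue `a`)
  have habs : |(a : ℝ)| ≤ 2 * Real.sqrt p := by
    have hev : Module.End.HasEigenvalue (heckeT (Gamma0 N) 2 p) (a : ℂ) := by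
      refine Module.End.hasEigenvalue_of_hasEigenvector ⟨Module.End.mem_eigenspace_iff.mpr ?_, hf0⟩
      rw [← anemicHeckeRing.coe_T N 2 p hp hpN, ← ht, intEigencharacter_spec hf hf0 t]
    have := h2 N p hp hpN _ hev
    rwa [Complex.norm_intCast] at this
  -- (6) `η ≤ (2 √p + |a|)^{#c} ≤ (4 √p)^{#c}`
  have hη := heckeCongruenceModulus_le_pow_finrank hf hf0 hP htP hqt (by positivity) hroots
  set r := Module.finrank ℤ (anemicHeckeRing N 2 ⧸ P) with hr
  have hp0 : (0 : ℝ) < p := by exact_mod_cast hp.pos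
  have hsqrt : 0 < Real.sqrt p := Real.sqrt_pos.mpr hp0
  have hη' : (heckeCongruenceModulus D.f P : ℝ) ≤ (4 * Real.sqrt p) ^ r :=
    hη.trans (pow_le_pow_left₀ (by positivity) (by linarith) r)
  -- (7) logarithms: `log η ≤ #c log(4 √p) = #c (log 4 + log p / 2) ≤ #c (log 4 + log X / 2)`
  have hηpos : (0 : ℝ) < heckeCongruenceModulus D.f P := by
    exact_mod_cast heckeCongruenceModulus_pos hf hf0 hP hPne
  have hlogη : Real.log (heckeCongruenceModulus D.f P) ≤ r * (Real.log 4 + Real.log p / 2) := by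
    have h := Real.log_le_log hηpos hη'
    rwa [Real.log_pow, Real.log_mul (by norm_num) hsqrt.ne', Real.log_sqrt hp0.le] at h
  have hlogp : Real.log p ≤ Real.log X := Real.log_le_log hp0 hpX
  have hr' : (0 : ℝ) ≤ r := Nat.cast_nonneg r
  calc Real.log (heckeCongruenceModulus D.f P)
      ≤ r * (Real.log 4 + Real.log p / 2) := hlogη
    _ ≤ r * (Real.log 4 + Real.log X / 2) := mul_le_mul_of_nonneg_left (by linarith) hr'

/-- **`log δ_{1,N} ≤ (Σ_{c ≠ [χ₀]} #c) · (log 4 + ½ log X)`** (Pasten, proof of Thm 7.2, p. 26: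
"Varying `c ≠ [χ_{D,M}]` … Theorem 5.5 gives `log δ_{D,M} ≤ Σ_{c ≠ [χ_{D,M}]} log η_{[χ_{D,M}]}(c)
< (r_{D,M} − 1) · (…)`"), for a datum `D` of minimal degree in its class at level `N`
(`D.modularDegree = δ_{1,N}`), from Thm 5.5 (`h55 : PastenShimura2024_thm_5_5`, via the sibling's
`log_modularDegree_le_sum_log_heckeCongruenceModulus`) and
`log_heckeCongruenceModulus_le_of_distinguishingIndex` (hypotheses `h2`, `hX` as there).
[cite: PastenShimura2024, proof of Thm. 7.2, p. 26] -/
theorem log_modularDegree_le_card_mul_of_distinguishingIndex (h55 : PastenShimura2024_thm_5_5)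
    (h2 : ∀ (N : ℕ) [NeZero N] (p : ℕ) [NeZero p], p.Prime → ¬ p ∣ N → ∀ μ : ℂ,
      Module.End.HasEigenvalue (heckeT (Gamma0 N) 2 p) μ → ‖μ‖ ≤ 2 * Real.sqrt p)
    {X : ℝ}
    (hX : ∀ (M : ℕ) [NeZero M], M ∣ N →
      ∀ (f : CuspForm (Gamma0 N) 2) (g : CuspForm (Gamma0 M) 2), IsNewform0 f → IsNewform0 g →
        (∃ n : ℕ, n.Coprime N ∧ (qExpansion 1 ⇑f).coeff n ≠ (qExpansion 1 ⇑g).coeff n) →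
          ∃ n : ℕ, n.Coprime N ∧ (n : ℝ) ≤ X ∧
            (qExpansion 1 ⇑f).coeff n ≠ (qExpansion 1 ⇑g).coeff n)
    [W.IsElliptic] (D : ModularParametrizationData W N)
    (hmin : ∀ (W' : WeierstrassCurve ℚ) [W'.IsElliptic] (D' : ModularParametrizationData W' N),
      D'.f = D.f → D.modularDegree ≤ D'.modularDegree) :
    Real.log (D.modularDegree : ℝ) ≤
      (∑ P ∈ (finite_minimalPrimes_anemicHeckeRing N 2).toFinset.erase (eigenIdeal D.f),
          (Module.finrank ℤ (anemicHeckeRing N 2 ⧸ P) : ℝ)) * (Real.log 4 + Real.log X / 2) := by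
  have h1 := log_modularDegree_le_sum_log_heckeCongruenceModulus h55 D hmin
  have h3 : ∑ P ∈ (finite_minimalPrimes_anemicHeckeRing N 2).toFinset.erase (eigenIdeal D.f),
        Real.log (heckeCongruenceModulus D.f P : ℝ) ≤
      ∑ P ∈ (finite_minimalPrimes_anemicHeckeRing N 2).toFinset.erase (eigenIdeal D.f),
        (Module.finrank ℤ (anemicHeckeRing N 2 ⧸ P) : ℝ) * (Real.log 4 + Real.log X / 2) := by
    refine Finset.sum_le_sum fun P hP =>
      log_heckeCongruenceModulus_le_of_distinguishingIndex h2 hX D ?_ ?_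
    · exact (finite_minimalPrimes_anemicHeckeRing N 2).mem_toFinset.mp (Finset.mem_of_mem_erase hP)
    · exact Finset.ne_of_mem_erase hP
  rw [← Finset.sum_mul] at h3
  exact h1.trans h3

/-! ### Thm 7.2, asymptotic clause, from Thm 5.5, Deligne's bound, Murty's Lemma 11 and Prop 7.1 -/

omit [NeZero N] in
/-- **Thm 7.2, asymptotic clause (`D = 1`, `M = N`), from its printed inputs** (p. 26: "given any
`ε > 0`, for `N ≫_ε 1` with an effective implicit constant, we have
`log δ_{D,M} < (1/24 + ε) φ(D) M log N`. … The proof of the asymptotic bound is similar, but using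
instead the (effective) estimate `n_c ≪_ε N^{1+ε}` from Lemma 11 in [MurtyBounds]"). For a datum
`D` of minimal degree in its class at level `N` (`D.modularDegree = δ_{1,N}`):
`log δ_{1,N} < (1/24 + ε) N log N` once `N ≥ N₁(ε)`, assuming
(i) Thm 5.5 (`h55 : PastenShimura2024_thm_5_5`);
(ii) `h2`, the weight-2 Ramanujan–Petersson bound for the eigenvalues of `T_p` on `S₂(Γ₀(N))`
("the Hasse–Weil bound"; `Deligne1974_heckeT_eigenvalue_norm_le.weight_two` in the tree);
(iii) `hMurty`, Lemma 11 of [MurtyBounds] as used here — for every `ε > 0` a constant `C` such that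
newforms `f ∈ S₂(Γ₀(N))`, `g ∈ S₂(Γ₀(M))`, `M ∣ N`, differing at some index prime to `N` differ at
an index `n ≤ C N^{1+ε}` prime to `N` ("`n_c ≪_ε N^{1+ε}`"; NOT in the tree — its proof is the
Rankin–Selberg method with level-uniform convexity and the Hoffstein–Lockhart bound);
(iv) `hr`, Prop 7.1 as used on p. 26, `Σ_{c ≠ [χ₀]} #c ≤ N/12 + (7/12) d(N²)` (`= r_{1,N} − 1`;
G. Martin's newform-dimension bound; NOT in the tree), classes read as the minimal primes
`P ≠ 𝕀_{[χ₀]}` of `𝕋 = anemicHeckeRing N 2`, `#c = rank_ℤ(𝕋 ⧸ P)` (the sibling's `hr`, verbatim).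
Then `log δ_{1,N} ≤ (1/12 + κ) N (log 4 + ½ log C + ((1 + κ)/2) log N)` with `κ = min(ε/3, 1)`,
which is `< (1/24 + ε) N log N` for `N` large (`exists_propBound_le`, `exists_mul_le_mul_mul_log`).
[cite: PastenShimura2024, Thm. 7.2 (asymptotic clause) and its proof, p. 26]
[cite: Murty1999CongruencePrimes, §6 Lemma 11] -/
theorem log_modularDegree_lt_of_thm_5_5_asymptotic (h55 : PastenShimura2024_thm_5_5)
    (h2 : ∀ (N : ℕ) [NeZero N] (p : ℕ) [NeZero p], p.Prime → ¬ p ∣ N → ∀ μ : ℂ,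
      Module.End.HasEigenvalue (heckeT (Gamma0 N) 2 p) μ → ‖μ‖ ≤ 2 * Real.sqrt p)
    (hMurty : ∀ ε : ℝ, 0 < ε → ∃ C : ℝ, ∀ (N M : ℕ) [NeZero N] [NeZero M], M ∣ N →
      ∀ (f : CuspForm (Gamma0 N) 2) (g : CuspForm (Gamma0 M) 2), IsNewform0 f → IsNewform0 g →
        (∃ n : ℕ, n.Coprime N ∧ (qExpansion 1 ⇑f).coeff n ≠ (qExpansion 1 ⇑g).coeff n) →
          ∃ n : ℕ, n.Coprime N ∧ (n : ℝ) ≤ C * (N : ℝ) ^ (1 + ε) ∧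
            (qExpansion 1 ⇑f).coeff n ≠ (qExpansion 1 ⇑g).coeff n)
    (hr : ∀ (N : ℕ) [NeZero N] (W : WeierstrassCurve ℚ) [W.IsElliptic]
      (D : ModularParametrizationData W N),
      (∑ P ∈ (finite_minimalPrimes_anemicHeckeRing N 2).toFinset.erase (eigenIdeal D.f),
          (Module.finrank ℤ (anemicHeckeRing N 2 ⧸ P) : ℝ)) ≤
        (N : ℝ) / 12 + 7 / 12 * ((N ^ 2).divisors.card : ℝ))
    {ε : ℝ} (hε : 0 < ε) :
    ∃ N₁ : ℕ, ∀ (N : ℕ) [NeZero N] (W : WeierstrassCurve ℚ) [W.IsElliptic]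
      (D : ModularParametrizationData W N),
      (∀ (W' : WeierstrassCurve ℚ) [W'.IsElliptic] (D' : ModularParametrizationData W' N),
          D'.f = D.f → D.modularDegree ≤ D'.modularDegree) →
        N₁ ≤ N → Real.log (D.modularDegree : ℝ) < (1 / 24 + ε) * (N : ℝ) * Real.log N := by
  -- the parameter `κ = min(ε/3, 1)` for both inputs, the constant `C ≥ 1`, the thresholds
  set κ : ℝ := min (ε / 3) 1 with hκ_def
  have hκ : 0 < κ := lt_min (by positivity) one_pos
  have hκ1 : κ ≤ 1 := min_le_right _ _
  have hκ3 : κ ≤ ε / 3 := min_le_left _ _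
  obtain ⟨C₀, hC₀⟩ := hMurty κ hκ
  set C : ℝ := max C₀ 1 with hC_def
  have hC1 : 1 ≤ C := le_max_right _ _
  obtain ⟨N₂, hN₂⟩ := exists_propBound_le hκ
  set K : ℝ := (1 / 12 + κ) * (Real.log 4 + Real.log C / 2) with hK_def
  obtain ⟨M₀, hM₀⟩ := exists_mul_le_mul_mul_log (ε := ε / 8) (by positivity) K
  refine ⟨max N₂ M₀, fun N _ W _ D hmin hN => ?_⟩
  have hN₂N : N₂ ≤ N := le_trans (le_max_left _ _) hN
  have hM₀N : M₀ ≤ N := le_trans (le_max_right _ _) hN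
  have h11 : 11 ≤ N := eleven_le_level D
  have hNpos : (0 : ℝ) < N := by exact_mod_cast (show 0 < N by omega)
  have hlogN : 0 < Real.log N := Real.log_pos (by exact_mod_cast (show 1 < N by omega))
  -- Murty's bound at level `N` with the constant `C ≥ C₀`: `X = C N^{1+κ}`
  have hX : ∀ (M : ℕ) [NeZero M], M ∣ N →
      ∀ (f : CuspForm (Gamma0 N) 2) (g : CuspForm (Gamma0 M) 2), IsNewform0 f → IsNewform0 g →
        (∃ n : ℕ, n.Coprime N ∧ (qExpansion 1 ⇑f).coeff n ≠ (qExpansion 1 ⇑g).coeff n) →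
          ∃ n : ℕ, n.Coprime N ∧ (n : ℝ) ≤ C * (N : ℝ) ^ (1 + κ) ∧
            (qExpansion 1 ⇑f).coeff n ≠ (qExpansion 1 ⇑g).coeff n := by
    intro M _ hM f g hf hg hex
    obtain ⟨n, hn, hnC, hne⟩ := hC₀ N M hM f g hf hg hex
    exact ⟨n, hn, hnC.trans (mul_le_mul_of_nonneg_right (le_max_left _ _) (by positivity)), hne⟩
  have hB := log_modularDegree_le_card_mul_of_distinguishingIndex h55 h2 hX D hmin
  have hlogX : Real.log (C * (N : ℝ) ^ (1 + κ)) = Real.log C + (1 + κ) * Real.log N := by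
    rw [Real.log_mul (by positivity) (by positivity), Real.log_rpow hNpos]
  rw [hlogX] at hB
  -- Prop 7.1: `Σ #c ≤ N/12 + (7/12) d(N²) ≤ (1/12 + κ) N`
  have hS := (hr N W D).trans (hN₂ N hN₂N)
  have hbr : 0 ≤ Real.log 4 + (Real.log C + (1 + κ) * Real.log N) / 2 := by
    have h4 : 0 ≤ Real.log 4 := Real.log_nonneg (by norm_num)
    have hC' : 0 ≤ Real.log C := Real.log_nonneg hC1
    have h3 : 0 ≤ (1 + κ) * Real.log N := mul_nonneg (by linarith) hlogN.le
    linarith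
  have hmain : Real.log (D.modularDegree : ℝ) ≤
      ((1 / 12 + κ) * N) * (Real.log 4 + (Real.log C + (1 + κ) * Real.log N) / 2) :=
    hB.trans (mul_le_mul_of_nonneg_right hS hbr)
  have hexp : ((1 / 12 + κ) * N) * (Real.log 4 + (Real.log C + (1 + κ) * Real.log N) / 2) =
      (1 / 12 + κ) * (1 + κ) / 2 * ((N : ℝ) * Real.log N) + K * N := by
    rw [hK_def]; ring
  have hKN := hM₀ N hM₀N
  have hsq : κ * κ ≤ κ := by nlinarith
  have hcoef : (1 / 12 + κ) * (1 + κ) / 2 ≤ 1 / 24 + 25 * ε / 72 := by nlinarith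
  have hNlogN : 0 < (N : ℝ) * Real.log N := mul_pos hNpos hlogN
  have hεX : 0 < ε * ((N : ℝ) * Real.log N) := mul_pos hε hNlogN
  calc Real.log (D.modularDegree : ℝ)
      ≤ (1 / 12 + κ) * (1 + κ) / 2 * ((N : ℝ) * Real.log N) + K * N := by rw [← hexp]; exact hmain
    _ ≤ (1 / 24 + 25 * ε / 72) * ((N : ℝ) * Real.log N) + ε / 8 * N * Real.log N :=
        add_le_add (mul_le_mul_of_nonneg_right hcoef hNlogN.le) hKN
    _ = (1 / 24 + ε) * N * Real.log N - 19 / 36 * (ε * ((N : ℝ) * Real.log N)) := by ring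
    _ < (1 / 24 + ε) * N * Real.log N := by linarith

end Pasten2024

open Pasten2024

/-- **Pasten, Thm 7.5 (asymptotic discriminant clause) from modularity, Mazur–Kenku, Thm 5.5,
the weight-2 Ramanujan bound, Murty's Lemma 11 and Prop 7.1.** Inputs:
(i) `nonempty_modularParametrizationData` (modularity with an integral Manin constant; Wiles,
Taylor–Wiles, Breuil–Conrad–Diamond–Taylor; Edixhoven); (ii) `PastenShimura2024_minimalDegree_le_163_mul`
(Mazur–Kenku, §3 p. 13); (iii) `PastenShimura2024_thm_5_5` (Thm 5.5, `δ_{1,N} ∣ ∏ η`);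
(iv) `h2`, the weight-2 Ramanujan–Petersson bound `|μ| ≤ 2√p` on `S₂(Γ₀(N))`;
(v) `hMurty`, Lemma 11 of [MurtyBounds] (`n_c ≪_ε N^{1+ε}`), and (vi) `hr`, Prop 7.1
(`r_{1,N} − 1 ≤ N/12 + (7/12) d(N²)`), both as on p. 26 and NOT vendored in the tree. The chain
(§7.4 p. 27 with §3 p. 13): `log|Δ_min| ≤ 6 log(minModularDegree) + 124 − 6 log 163` (sibling, from
modularity), `minModularDegree ≤ 163 δ_{1,N}` (ii), and Thm 7.2's asymptotic clause
(`Pasten2024.log_modularDegree_lt_of_thm_5_5_asymptotic`, from (iii)–(vi)), assembled by the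
sibling's `pasten_thm_7_5_of_modularity_of_optimalDegreeBound`.
[cite: PastenShimura2024, Theorem 7.5 (proof, §7.4 p. 27) with Thm 7.2 (proof, p. 26)] -/
theorem pasten_thm_7_5_of_modularity_of_thm_5_5_of_weight_two_bound
    (hmod : nonempty_modularParametrizationData)
    (h163 : PastenShimura2024_minimalDegree_le_163_mul)
    (h55 : PastenShimura2024_thm_5_5)
    (h2 : ∀ (N : ℕ) [NeZero N] (p : ℕ) [NeZero p], p.Prime → ¬ p ∣ N → ∀ μ : ℂ,
      Module.End.HasEigenvalue (heckeT (Gamma0 N) 2 p) μ → ‖μ‖ ≤ 2 * Real.sqrt p)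
    (hMurty : ∀ ε : ℝ, 0 < ε → ∃ C : ℝ, ∀ (N M : ℕ) [NeZero N] [NeZero M], M ∣ N →
      ∀ (f : CuspForm (Gamma0 N) 2) (g : CuspForm (Gamma0 M) 2), IsNewform0 f → IsNewform0 g →
        (∃ n : ℕ, n.Coprime N ∧ (qExpansion 1 ⇑f).coeff n ≠ (qExpansion 1 ⇑g).coeff n) →
          ∃ n : ℕ, n.Coprime N ∧ (n : ℝ) ≤ C * (N : ℝ) ^ (1 + ε) ∧
            (qExpansion 1 ⇑f).coeff n ≠ (qExpansion 1 ⇑g).coeff n)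
    (hr : ∀ (N : ℕ) [NeZero N] (W : WeierstrassCurve ℚ) [W.IsElliptic]
      (D : ModularParametrizationData W N),
      (∑ P ∈ (finite_minimalPrimes_anemicHeckeRing N 2).toFinset.erase (eigenIdeal D.f),
          (Module.finrank ℤ (anemicHeckeRing N 2 ⧸ P) : ℝ)) ≤
        (N : ℝ) / 12 + 7 / 12 * ((N ^ 2).divisors.card : ℝ)) :
    pasten_thm_7_5 :=
  pasten_thm_7_5_of_modularity_of_optimalDegreeBound hmod h163
    fun _ hε => log_modularDegree_lt_of_thm_5_5_asymptotic h55 h2 hMurty hr hε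

/-- **Pasten, Thm 7.5 (asymptotic discriminant clause) from modularity and the named facts of the
tree, modulo the two un-vendored inputs of Thm 7.2.** As
`pasten_thm_7_5_of_modularity_of_thm_5_5_of_weight_two_bound`, with the weight-2 Ramanujan bound
supplied by the named fact `Deligne1974_heckeT_eigenvalue_norm_le` (Deligne 1974, Thm 8.2; its
weight-2 case `.weight_two`). Of the six inputs, (i) `nonempty_modularParametrizationData`,
(ii) `PastenShimura2024_minimalDegree_le_163_mul`, (iii) `PastenShimura2024_thm_5_5` and
(iv) `Deligne1974_heckeT_eigenvalue_norm_le` are named facts of the tree, and only (v) Murty's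
Lemma 11 (`hMurty`) and (vi) Prop 7.1 (`hr`) are un-vendored statements; nothing else of the
printed proof of Thm 7.5 remains unproved.
[cite: PastenShimura2024, Theorem 7.5 (proof, §7.4 p. 27) with Thm 7.2 (proof, p. 26)]
[cite: Deligne1974, Thm. 8.2] [cite: Murty1999CongruencePrimes, §6 Lemma 11] -/
theorem pasten_thm_7_5_of_modularity_of_thm_5_5
    (hmod : nonempty_modularParametrizationData)
    (h163 : PastenShimura2024_minimalDegree_le_163_mul)
    (h55 : PastenShimura2024_thm_5_5)
    (hDel : Deligne1974_heckeT_eigenvalue_norm_le)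
    (hMurty : ∀ ε : ℝ, 0 < ε → ∃ C : ℝ, ∀ (N M : ℕ) [NeZero N] [NeZero M], M ∣ N →
      ∀ (f : CuspForm (Gamma0 N) 2) (g : CuspForm (Gamma0 M) 2), IsNewform0 f → IsNewform0 g →
        (∃ n : ℕ, n.Coprime N ∧ (qExpansion 1 ⇑f).coeff n ≠ (qExpansion 1 ⇑g).coeff n) →
          ∃ n : ℕ, n.Coprime N ∧ (n : ℝ) ≤ C * (N : ℝ) ^ (1 + ε) ∧
            (qExpansion 1 ⇑f).coeff n ≠ (qExpansion 1 ⇑g).coeff n)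
    (hr : ∀ (N : ℕ) [NeZero N] (W : WeierstrassCurve ℚ) [W.IsElliptic]
      (D : ModularParametrizationData W N),
      (∑ P ∈ (finite_minimalPrimes_anemicHeckeRing N 2).toFinset.erase (eigenIdeal D.f),
          (Module.finrank ℤ (anemicHeckeRing N 2 ⧸ P) : ℝ)) ≤
        (N : ℝ) / 12 + 7 / 12 * ((N ^ 2).divisors.card : ℝ)) :
    pasten_thm_7_5 :=
  pasten_thm_7_5_of_modularity_of_thm_5_5_of_weight_two_bound hmod h163 h55
    (fun N _ p _ hp hpN μ hμ ↦ Deligne1974_heckeT_eigenvalue_norm_le.weight_two hDel N p hp hpN μ hμ)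
    hMurty hr

end Literature.NumberTheory.EllipticCurves

end
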